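import Literature.NumberTheory.EllipticCurves.ComplexMultiplicationBurungaleFlachDescentDeuringProofs
import Literature.NumberTheory.EllipticCurves.ComplexMultiplicationBurungaleFlachCorOneLeavesProofs
import HarnessLib

/-!
# bsd.S28 (Burungale–Flach) from eight leaves: the assembly on the level-5 descent

Sibling of `ComplexMultiplicationBurungaleFlachDescentDeuringProofs.lean` (level 5 of the descent
`Literature.NumberTheory.EllipticCurves.BurungaleFlach2024_bsd_rat_of_bsd_cmField` =
Burungale–Flach, Camb. J. Math. 12 (2024), proof of Cor. 2 at `F⁺ = ℚ`, from the leaves of complex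
multiplication; this is the sibling announced there under the working name
`…NineLeavesProofs.lean` — eight leaves, not nine, because the CM period lattice has meanwhile
become a theorem), of `ComplexMultiplicationBurungaleFlachCorOneLeavesProofs.lean` (Corollary 1 over
the CM field `K` from its current leaves, with the Deuring–Hecke continuation in place of
modularity) and of `ComplexMultiplicationBurungaleFlachAssemblyProofs.lean` (bsd.S28 from the
eleven leaves of its decomposition as of 2026-08-14). It adds no mathematics beyond one
substitution and records the resulting census:

* `BurungaleFlach2024_finite_primary_cmField_of_Deuring` (**proved**): the finiteness half of
  Theorem 1.1 over `K` (`BurungaleFlach2024_finite_primary_cmField`, Prop. 4.1; Remark 10: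
  Coates–Wiles 1977 and Rubin 1987) from Coates–Wiles finiteness over `ℚ`, Rubin 1987 §10,
  Deuring's identity and the Deuring–Hecke continuation — the rerun
  `BurungaleFlach2024_finite_primary_cmField_of_classical_of_hecke` of the sibling with its one
  use of Knapp 11.67 (`L(E^{(d_K)}, 1) = L(E, 1)` along the twist isogeny) replaced by Deuring's
  identity (`entireLFunction_quadraticTwist_eq_of_Deuring`), so **without**
  `LFunction_eq_of_isIsogenous`;
* `bsdTriple_of_j_mem_maximalCMJInvariants_of_L_one_ne_zero_of_eight_leaves` (**proved**): bsd.S28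
  (`bsdTriple_of_j_mem_maximalCMJInvariants_of_L_one_ne_zero`, the full Birch–Swinnerton-Dyer
  statement for `E/ℚ` with CM by `𝓞_K` and `L(E,1) ≠ 0`; Burungale–Flach Thm. 1.1, Cor. 1, Cor. 2)
  from **eight** named facts: Prop. 2.3 with Lemma 13 at `F = K` (the paper's contribution),
  Rubin 1987 §10, Coates–Wiles 1977 §6, the Deuring–Hecke continuation, Deuring's identity,
  Milne 1972 Thm. 1 (quotient form), Cassels' isogeny invariance and `L(E,1) ≥ 0`. Compared with
  the eleven of `…_of_eleven_leaves`: the three singular moduli (leaf 4) and the six CM twist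
  isogenies (leaf 11) are theorems by now (`singularModuli_classNumberOne_three_holds`,
  `isIsogenous_quadraticTwist_cmFieldDiscr_holds`); modularity (leaf 5) is weakened to the CM
  continuation; Artin formalism (leaf 6) and the Euler factors of the Tate module behind Knapp
  11.67 (leaf 9) drop out in favour of Deuring's identity, which the eleven-leaf assembly derived
  *from* them (`Deuring_LFunction_baseChange_cmField_of_artinFormalism`);
* `…_of_eight_leaves_of_eleven` (bookkeeping): the eight are among, or consequences of, the nine
  surviving hypotheses of the eleven-leaf assembly, so this is a refinement of the trust base, not
  a trade.

So bsd.S28 rests, sorry-free, on the theory of complex multiplication (Burungale–Flach's `p`-part,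
Rubin, Coates–Wiles, Deuring, Deuring–Hecke), Milne 1972 Thm. 1, Cassels 1965 and the sign of
`L(E,1)` (Guo 1996 / Lapid–Rallis 2003).

## Design and faithfulness notes

* Nothing is restated and no named fact is introduced: every hypothesis is an existing named fact
  of the tree; the conclusions are literally the existing leaf
  `BurungaleFlach2024_finite_primary_cmField` and the bsd.S28 fact. Corollary 1 over `K` is taken
  from the sibling (`BurungaleFlach2024_bsd_cmField_of_printed_leaves`), the descent from level 5.
* Group rules of the topic: `noncomputable section`, `open scoped Classical`.

## References

* A. Burungale, M. Flach, *The conjecture of Birch and Swinnerton-Dyer for certain elliptic curves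
  with complex multiplication*, Camb. J. Math. 12 (2024) (arXiv:2206.09874): Thm. 1.1 and its
  proof (arXiv p. 22), Cor. 1, Cor. 2 (pp. 3–4), Prop. 4.1 and Remark 10 (p. 19).
  [BurungaleFlach2024]
* J. Coates, A. Wiles, Invent. Math. 39 (1977), Thm. 1. [CoatesWiles1977]
* K. Rubin, Invent. Math. 89 (1987), Thm. A and §10. [Rubin1987Sha]
* J. H. Silverman, *Advanced Topics in the Arithmetic of Elliptic Curves* (1994), Ch. II Thm. 10.5
  and Cor. 10.5.1 (Deuring, Deuring–Hecke). [SilvermanATAEC1994]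
-/

noncomputable section

open scoped Classical

namespace Literature.NumberTheory.EllipticCurves

open WeierstrassCurve NumberField

/-! ### The finiteness half of Theorem 1.1 without Knapp 11.67 -/

/-- **The finiteness half of Theorem 1.1 over the CM field from Coates–Wiles and Rubin, without
Knapp 11.67** (Burungale–Flach, Remark 10: *"the finiteness of the Mordell–Weil group is due to
Coates and Wiles, Arthaud and Rubin. For `L = K` the finiteness of the Tate–Shafarevich group is
due to Rubin [rubin87]"*). Same proof as
`BurungaleFlach2024_finite_primary_cmField_of_classical` (`…FiniteProofs.lean`) and its rerun
`…_of_classical_of_hecke` (`…CorOneLeavesProofs.lean`): `E(ℚ)` finite by Coates–Wiles (`hF1`);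
`E^{(d_K)}(ℚ)` finite by Coates–Wiles for the twist, which has the same `j` and the same value
`L(E^{(d_K)},1) = L(E,1) ≠ 0` — here by Deuring's identity
(`entireLFunction_quadraticTwist_eq_of_Deuring`) instead of the isogeny `E ∼ E^{(d_K)}` and
Knapp 11.67; hence `E(K)` finite (`finite_point_baseChange_of_finite_of_finite_quadraticTwist`);
`Ш(E_K/K)[p^∞]` finite by Rubin 1987 §10 (`hR`), whose hypothesis `L(E_K/K,1) ≠ 0` is
`L(E/ℚ,1)² ≠ 0` by Deuring (`hD`) and the Deuring–Hecke continuation (`hH`); both statements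
transported to the globally minimal model `W' = C • E_K`.
[cite: BurungaleFlach2024, Prop. 4.1 with Remark 10 (arXiv p. 19)]
[cite: CoatesWiles1977, Thm 1 (p. 223)] [cite: Rubin1987Sha, §10, proof of Thm. A, p. 549] -/
theorem BurungaleFlach2024_finite_primary_cmField_of_Deuring
    (hF1 : finite_point_of_j_mem_maximalCMJInvariants_of_L_one_ne_zero)
    (hR : Rubin1987_sha_primary_finite) (hD : Deuring_LFunction_baseChange_cmField)
    (hH : hasEntireLFunction_of_j_mem_maximalCMJInvariants) :
    BurungaleFlach2024_finite_primary_cmField := by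
  intro W _ hj hL K _ _ hK W' _ _ hW' p hp
  obtain ⟨C, rfl⟩ := hW'
  -- the square-root generator of the CM field: `θ² = d_K`, `θ ∉ ℚ`
  obtain ⟨θ, hθ', hc⟩ := hK.exists_sqrt hj
  have hd0 : (cmFieldDiscr W.j : ℚ) ≠ 0 :=
    QuadraticFields.Quadratic.sq_ne_zero_of_not_mem_range hθ' hc
  -- `E(ℚ)` and `E^{(d_K)}(ℚ)` are finite (Coates–Wiles, for `E` and for its twist)
  have hfinQ : Finite W.toAffine.Point := hF1 W hj hL
  haveI : (W.quadraticTwist (cmFieldDiscr W.j : ℚ)).IsElliptic := W.isElliptic_quadraticTwist hd0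
  have hjd : (W.quadraticTwist (cmFieldDiscr W.j : ℚ)).j ∈ maximalCMJInvariants := by
    rw [W.j_quadraticTwist hd0]
    exact hj
  have hLd : (W.quadraticTwist (cmFieldDiscr W.j : ℚ)).entireLFunction 1 ≠ 0 := by
    rw [entireLFunction_quadraticTwist_eq_of_Deuring hD W hj K hK hθ' hc]
    exact hL
  have hfinQd : Finite (W.quadraticTwist (cmFieldDiscr W.j : ℚ)).toAffine.Point :=
    hF1 (W.quadraticTwist (cmFieldDiscr W.j : ℚ)) hjd hLd
  -- hence `E(K)` is finite, and so is `W'(K) ≅ E(K)`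
  have hfinK : Finite (W.baseChange K).toAffine.Point :=
    W.finite_point_baseChange_of_finite_of_finite_quadraticTwist hK.1 hθ' hc hfinQ hfinQd
  have hfinW' : Finite (C • W.baseChange K).toAffine.Point :=
    Finite.of_equiv _ (VariableChange.pointEquiv (W.baseChange K) C).toEquiv
  -- `L(E_K/K, 1) = L(E/ℚ, 1)² ≠ 0`, so Rubin 1987 §10 applies to `E_K`
  have hLK : (W.baseChange K).entireLFunction 1 ≠ 0 := by
    rw [entireLFunction_one_eq_sq_of_LFunction_eq_mul_self (hH W hj) (hD W hj K hK)]
    exact pow_ne_zero 2 hL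
  have hprim : Set.Finite {c : (W.baseChange K).sha | ∃ j : ℕ, p ^ j • c = 0} :=
    hR W hj K hK hLK p hp
  exact ⟨hfinW', ((W.baseChange K).finite_sha_primary_variableChange_iff C p).mpr hprim⟩

/-! ### bsd.S28 from eight leaves -/

/-- **bsd.S28 from eight leaves.** bsd.S28
(`bsdTriple_of_j_mem_maximalCMJInvariants_of_L_one_ne_zero`: the full Birch–Swinnerton-Dyer
statement for `E/ℚ` with CM by `𝓞_K` and `L(E,1) ≠ 0`; Burungale–Flach 2024, Thm. 1.1, Cor. 1,
Cor. 2) follows, sorry-free, from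

1. `BurungaleFlach2024_main_cmField_pPart` (`hB`) — Prop. 2.3 with Lemma 13 at `F = K` for every
   `p` (the paper's contribution: Johnson-Leung–Kings, the descent Prop. 4.1, Kato's reciprocity);
2. `Rubin1987_sha_primary_finite` (`hR`) — Rubin 1987, §10;
3. `CoatesWiles1977_L_one_div_period_mem_prime` (`h1`) — Coates–Wiles 1977, §6;
4. `hasEntireLFunction_of_j_mem_maximalCMJInvariants` (`hH`) — the Deuring–Hecke continuation of
   `L(E/ℚ, s)` for CM by `𝓞_K` (Silverman *Advanced Topics* II Cor. 10.5.1);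
5. `Deuring_LFunction_baseChange_cmField` (`hD`) — Deuring, `L(E_K/K,s) = L(E/ℚ,s)²`;
6. `bsdRHS_baseChange_quadratic` (`hBC`) — Milne 1972, Thm. 1, rank-zero quotient form;
7. `bsdRHS_eq_of_isIsogenous` (`hISO`) — Cassels 1965 / Milne *ADT* I.7.3;
8. `re_entireLFunction_one_nonneg` (`hPOS`) — `L(E,1) ≥ 0` (Guo 1996; Lapid–Rallis 2003).

The chain: Coates–Wiles with Mordell–Weil and the nine singular moduli (theorems) ⇒ `E(ℚ)` finite
(`finite_point_of_j_mem_maximalCMJInvariants_of_L_one_ne_zero_of_pAdicDivisibility`); the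
finiteness half of Thm. 1.1 (`BurungaleFlach2024_finite_primary_cmField_of_Deuring`); Cor. 1
over `K` (`BurungaleFlach2024_bsd_cmField_of_printed_leaves`, the sibling's rerun of the printed
proof on the CM continuation and the proved CM period lattice); the level-5 descent
(`BurungaleFlach2024_bsd_rat_of_bsd_cmField_of_level5`); the level-2 assembly.
[cite: BurungaleFlach2024, Thm. 1.1 and its proof, Cor. 1, Cor. 2, Remark 10 (arXiv pp. 3–4, 19, 22)] -/
theorem bsdTriple_of_j_mem_maximalCMJInvariants_of_L_one_ne_zero_of_eight_leaves
    (hB : BurungaleFlach2024_main_cmField_pPart) (hR : Rubin1987_sha_primary_finite)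
    (h1 : CoatesWiles1977_L_one_div_period_mem_prime)
    (hH : hasEntireLFunction_of_j_mem_maximalCMJInvariants)
    (hD : Deuring_LFunction_baseChange_cmField)
    (hBC : bsdRHS_baseChange_quadratic) (hISO : bsdRHS_eq_of_isIsogenous)
    (hPOS : re_entireLFunction_one_nonneg) :
    bsdTriple_of_j_mem_maximalCMJInvariants_of_L_one_ne_zero :=
  bsdTriple_of_j_mem_maximalCMJInvariants_of_L_one_ne_zero_of_level2
    (BurungaleFlach2024_bsd_cmField_of_printed_leaves
      (BurungaleFlach2024_finite_primary_cmField_of_Deuring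
        (finite_point_of_j_mem_maximalCMJInvariants_of_L_one_ne_zero_of_pAdicDivisibility h1)
        hR hD hH)
      hB hD hH)
    (BurungaleFlach2024_bsd_rat_of_bsd_cmField_of_level5 hH hD hBC hISO hPOS)

/-- **The eight leaves refine the eleven** of
`bsdTriple_of_j_mem_maximalCMJInvariants_of_L_one_ne_zero_of_eleven_leaves` (bookkeeping): of the
eleven hypotheses, the three singular moduli and the six twist isogenies are theorems and are
omitted; from the remaining nine, the CM continuation follows from modularity
(`hasEntireLFunction_of_j_mem_maximalCMJInvariants_of_hasEntireLFunction_rat`) and Deuring's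
identity from Artin formalism, the Euler factors of the Tate module (Knapp 11.67) and the twist
isogenies (`Deuring_LFunction_baseChange_cmField_of_artinFormalism`).
[cite: BurungaleFlach2024, Thm. 1.1, Cor. 1, Cor. 2 (arXiv pp. 3–4, 22)] -/
theorem bsdTriple_of_j_mem_maximalCMJInvariants_of_L_one_ne_zero_of_eight_leaves_of_eleven
    (hB : BurungaleFlach2024_main_cmField_pPart) (hR : Rubin1987_sha_primary_finite)
    (h1 : CoatesWiles1977_L_one_div_period_mem_prime) (hmod : hasEntireLFunction_rat)
    (hBCL : LSeries_baseChange_quadratic) (hBC : bsdRHS_baseChange_quadratic)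
    (hISO : bsdRHS_eq_of_isIsogenous)
    (hHW : ∀ (W : WeierstrassCurve ℚ) [W.IsElliptic] (ℓ : ℕ) [Fact ℓ.Prime],
      W.hasseWeilEulerFactor_geomPoints ℓ)
    (hPOS : re_entireLFunction_one_nonneg) :
    bsdTriple_of_j_mem_maximalCMJInvariants_of_L_one_ne_zero :=
  bsdTriple_of_j_mem_maximalCMJInvariants_of_L_one_ne_zero_of_eight_leaves hB hR h1
    (hasEntireLFunction_of_j_mem_maximalCMJInvariants_of_hasEntireLFunction_rat hmod)
    (Deuring_LFunction_baseChange_cmField_of_artinFormalism hBCL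
      isIsogenous_quadraticTwist_cmFieldDiscr_holds
      (LFunction_eq_of_isIsogenous_of_hasseWeilEulerFactor_geomPoints hHW))
    hBC hISO hPOS

end Literature.NumberTheory.EllipticCurves

end
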